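import Summits.ResolutionOfSingularities.ResolutionOfSingularities.Theorems.PurelyInseparableDim4JointForestRootNormalised
import HarnessLib

/-!
# Purely inseparable four-folds: the DEPTH-TWO CERTIFICATE KIT for the monotone joint forest — one coordinate member, planned
# children and leaves that are DEAD after one more blow-up (brick S3 (c) «joint point∘coordinate chains», part 25, cell `res-dim4-pi`)

[OURS · counted 0] (D-0157 DOOR 2; desk WORD #66 (4)(c), #74 (g), #99 (d); frame `PIDim4.TerminationImpliesOrderReduction`,
S3 (c); host item stmt-ResolutionOfSingularities-16155, helper). Nothing here proves resolution of singularities in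
dimension ≥ 4 / characteristic `p` — NOT here, not anywhere in this programme.

Parts 16, 22b, 23b, 24c are certificates of the same shape: ONE initial member `(b₀, S)` carrying every closed order-`p` point of
`z^p + F`; over it finitely many planned CHILDREN (entries `(j, b, S″)`, pairwise separated, covering the normalised equimultiple
pairs together with finitely many LEAVES); and every child / leaf is DEAD: its state has no equimultiple pair for its own centre
(`S″`, resp. the point `univ`), so nothing of order `p` survives the second round. This file packages that shape ONCE, over part 21's
`exists_isMarkedResolution_joint_forest_root_normalised`, so that future ‖ K certificates are a page of polynomial computations:

* `acc_edge_of_no_pairs`, `eq_of_reflTransGen_edge_of_no_pairs`, `finite_pairs_of_no_pairs` — a state without equimultiple pairs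
  (for `univ`) has an EMPTY point walk;
* **`exists_isMarkedResolution_depth_two_cert`** — THE KIT THEOREM (hypotheses on `F`, `b₀`, `S`, the entry set `Pl` and the leaf set
  `L` only; `K = K̄`).

AI-produced formalisation, weaker than expert review. bears_on: LADDER-RESOLUTION:D157-DOOR2 (res-dim4-pi · S3 (c) joint v2 · kit).
-/

set_option linter.dupNamespace false -- D-0017: single-problem summit path `Summit.<S>.<S>.…` by design

noncomputable section

open MvPolynomial Finset CategoryTheory AlgebraicGeometry Opposite TopologicalSpace

namespace Summit.ResolutionOfSingularities.ResolutionOfSingularities.Theorems.PIDim4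

open Literature.AlgebraicGeometry.Resolution
open Literature.AlgebraicGeometry.Resolution.Hauser2010
open Literature.AlgebraicGeometry.Resolution.AffinePointBlowup (P A γ coord Wtop ξ)

namespace Equimultiple

/-! ## §1 Dead states: empty point walks -/

section Dead

variable {K : Type} [Field K] {p : ℕ} [DecidableEq K]

/-- A state with no equimultiple pair (for the point centre) has no edge out of it, so the flipped edge relation is accessible
there. [folklore] -/
theorem acc_edge_of_no_pairs (s : State K)
    (hs : ∀ (k : Fin 4) (c : Fin 4 → K), c k = 0 → ¬ CentreBlowup.IsEquimultiplePoint p Finset.univ k c s) :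
    Acc (fun s' s : State K => Edge p Finset.univ s s') s :=
  Acc.intro _ fun _ ⟨k, c, _, hck, heq, _, _⟩ => absurd heq (hs k c hck)

/-- … every state reachable from it by edges is itself … [folklore] -/
theorem eq_of_reflTransGen_edge_of_no_pairs (s : State K)
    (hs : ∀ (k : Fin 4) (c : Fin 4 → K), c k = 0 → ¬ CentreBlowup.IsEquimultiplePoint p Finset.univ k c s) (s' : State K)
    (hs' : Relation.ReflTransGen (fun a e : State K => Edge p Finset.univ a e) s s') : s' = s := by
  induction hs' with
  | refl => rfl
  | tail _ he ih =>
    subst ih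
    obtain ⟨k, c, -, hck, heq, -, -⟩ := he
    exact absurd heq (hs k c hck)

/-- … and carries finitely many (no) equimultiple pairs. [folklore] -/
theorem finite_pairs_of_no_pairs (s : State K)
    (hs : ∀ (k : Fin 4) (c : Fin 4 → K), c k = 0 → ¬ CentreBlowup.IsEquimultiplePoint p Finset.univ k c s) (s' : State K)
    (hs' : Relation.ReflTransGen (fun a e : State K => Edge p Finset.univ a e) s s') :
    {jb : Fin 4 × (Fin 4 → K) | jb.2 jb.1 = 0 ∧ CentreBlowup.IsEquimultiplePoint p Finset.univ jb.1 jb.2 s'}.Finite := by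
  rw [eq_of_reflTransGen_edge_of_no_pairs s hs s' hs']
  refine Set.finite_empty.subset ?_
  rintro ⟨k, c⟩ ⟨hck, heq⟩
  exact hs k c hck heq

end Dead

/-! ## §2 The kit theorem -/

section Kit

variable {K : Type} [Field K] {p : ℕ} [hp : Fact p.Prime] [CharP K p]

/-- **DEPTH-TWO CERTIFICATE KIT.** `K = K̄` of characteristic `p`, `F ≠ 0` clean; ONE initial member `(b₀, S)` (`V(z, x_S)`
permissible for the re-centred cleaned equation, state `s₀`) carrying every root parameter; a finite ENTRY set `Pl` (`j ∈ S`, `b_j = 0`,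
`S ⊆ S″`, equimultiple, `S″` permissible for the child; pairwise separated) and a finite LEAF set `L`, together COVERING every normalised
equimultiple pair of `s₀`; every CHILD state dead for its `S″` and every LEAF state dead for the point centre ⇒
`(𝔸⁵_K, (z^p + F)·𝒪, [], p)` admits a marked resolution (BGMW Def. 3.1.3). [cite: BierstoneGrigorievMilmanWlodarczyk2011, Def. 3.1.3]
[cite: HauserPerlega2019PRIMS, §2] [cite: Hauser2010, §F (equiconstant points)] -/
theorem exists_isMarkedResolution_depth_two_cert [IsAlgClosed K] [DecidableEq K] (F : MvPolynomial (Fin 4) K) (hF : F ≠ 0)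
    (hclean : Literature.Barriers.ResolutionOfSingularities.HauserPerlega.IsClean p F) (b₀ : Fin 4 → K) (S : Finset (Fin 4))
    (s₀ : State K) (hs₀ : s₀ = ⟨deletePthPowers p (PointBlowup.translate b₀ F), 0, ∅⟩)
    (hS : IsPermissibleCentre p S s₀.F)
    (hroots : ∀ b' : Fin 4 → K, (∀ d : Fin 4 →₀ ℕ, d ≠ 0 → d.degree < p → coeff d (PointBlowup.translate b' F) = 0) →
      ∀ i ∈ S, b' i = b₀ i)
    (Pl : Finset (Fin 4 × (Fin 4 → K) × Finset (Fin 4))) (L : Finset (Fin 4 × (Fin 4 → K)))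
    (hP1 : ∀ e ∈ Pl, e.1 ∈ S ∧ e.2.1 e.1 = 0 ∧ S ⊆ e.2.2 ∧ CentreBlowup.IsEquimultiplePoint p S e.1 e.2.1 s₀ ∧
      IsPermissibleCentre p e.2.2 (CentreBlowup.step p S e.1 e.2.1 s₀).F)
    (hP2 : ∀ e ∈ Pl, ∀ e' ∈ Pl, e ≠ e' →
      (e.1 = e'.1 ∧ ∃ i ∈ e.2.2, i ∈ e'.2.2 ∧ e.2.1 i ≠ e'.2.1 i) ∨
      (e.1 ≠ e'.1 ∧ ((e'.2.1 e.1 = 0 ∧ e.1 ∈ e'.2.2) ∨ (e.2.1 e'.1 = 0 ∧ e'.1 ∈ e.2.2))))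
    (hcover : ∀ (j' : Fin 4) (b' : Fin 4 → K), j' ∈ S → b' j' = 0 → (∀ k ∈ S, k < j' → b' k = 0) →
      CentreBlowup.IsEquimultiplePoint p S j' b' s₀ →
      (∃ e ∈ Pl, e.1 = j' ∧ ∀ i ∈ e.2.2, b' i = e.2.1 i) ∨ (j', b') ∈ L)
    (hdead_child : ∀ e ∈ Pl, ∀ (j'' : Fin 4) (b'' : Fin 4 → K), j'' ∈ e.2.2 → b'' j'' = 0 →
      ¬ CentreBlowup.IsEquimultiplePoint p e.2.2 j'' b'' (CentreBlowup.step p S e.1 e.2.1 s₀))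
    (hdead_leaf : ∀ l ∈ L, ∀ (k : Fin 4) (c : Fin 4 → K), c k = 0 →
      ¬ CentreBlowup.IsEquimultiplePoint p Finset.univ k c (CentreBlowup.step p S l.1 l.2 s₀)) :
    ∃ (X' : Scheme.{0}) (ρ : X' ⟶ P 4 K) (M' : MarkedIdeal X'),
      IsMarkedResolution (⟨hypSheaf p F, [], p⟩ : MarkedIdeal (P 4 K)) ρ M' := by
  classical
  have hS' : IsPermissibleCentre p S (deletePthPowers p (PointBlowup.translate b₀ F)) := by rw [hs₀] at hS; exact hS
  -- a child equal to the root state would contradict its own deadness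
  have hne : ∀ e ∈ Pl, (CentreBlowup.step p S e.1 e.2.1 s₀, e.2.2) ≠ (s₀, S) := fun e he h => by
    obtain ⟨hj, hbj, -, heq, -⟩ := hP1 e he
    have h1 : CentreBlowup.step p S e.1 e.2.1 s₀ = s₀ := congrArg Prod.fst h
    have h2 : e.2.2 = S := congrArg Prod.snd h
    have := hdead_child e he e.1 e.2.1 (h2 ▸ hj) hbj
    rw [h1, h2] at this
    exact this heq
  -- the rules
  let plan : State K → Finset (Fin 4) → Finset (Fin 4 × (Fin 4 → K) × Finset (Fin 4)) := fun s T =>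
    if (s, T) = (s₀, S) then Pl else ∅
  let leaves : State K → Finset (Fin 4) → Finset (Fin 4 × (Fin 4 → K)) := fun s T =>
    if (s, T) = (s₀, S) then L else ∅
  have hplan₀ : plan s₀ S = Pl := if_pos rfl
  have hleaves₀ : leaves s₀ S = L := if_pos rfl
  have hplan₁ : ∀ e ∈ Pl, plan (CentreBlowup.step p S e.1 e.2.1 s₀) e.2.2 = ∅ := fun e he => if_neg (hne e he)
  have hleaves₁ : ∀ e ∈ Pl, leaves (CentreBlowup.step p S e.1 e.2.1 s₀) e.2.2 = ∅ := fun e he => if_neg (hne e he)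
  -- reachable states: the root and its children
  have hreach : ∀ q : State K × Finset (Fin 4),
      Relation.ReflTransGen (fun q q' : State K × Finset (Fin 4) =>
        ∃ e ∈ plan q.1 q.2, q' = (CentreBlowup.step p q.2 e.1 e.2.1 q.1, e.2.2)) (s₀, S) q →
      q = (s₀, S) ∨ ∃ e ∈ Pl, q = (CentreBlowup.step p S e.1 e.2.1 s₀, e.2.2) := by
    intro q hq
    induction hq with
    | refl => exact Or.inl rfl
    | tail _ hR ih =>
      obtain ⟨e, he, rfl⟩ := hR
      rcases ih with h | ⟨e₀, he₀, h⟩ <;> rw [h] at he ⊢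
      · rw [hplan₀] at he
        exact Or.inr ⟨e, he, rfl⟩
      · rw [hplan₁ e₀ he₀] at he
        exact absurd he (Finset.notMem_empty e)
  have hacc₁ : ∀ e ∈ Pl, Acc (fun q' q : State K × Finset (Fin 4) =>
      ∃ e ∈ plan q.1 q.2, q' = (CentreBlowup.step p q.2 e.1 e.2.1 q.1, e.2.2)) (CentreBlowup.step p S e.1 e.2.1 s₀, e.2.2) :=
    fun e he => Acc.intro _ fun q' ⟨e', he', _⟩ => by
      rw [hplan₁ e he] at he'
      exact absurd he' (Finset.notMem_empty e')
  have hacc₀ : Acc (fun q' q : State K × Finset (Fin 4) =>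
      ∃ e ∈ plan q.1 q.2, q' = (CentreBlowup.step p q.2 e.1 e.2.1 q.1, e.2.2)) (s₀, S) :=
    Acc.intro _ fun q' ⟨e, he, hq'⟩ => by
      rw [hplan₀] at he
      rw [hq']
      exact hacc₁ e he
  refine exists_isMarkedResolution_joint_forest_root_normalised F hF hclean plan leaves {(b₀, S)} (fun bS hbS => ?_)
    (fun bS hbS bS' hbS' hne' => ?_) (Set.finite_empty.subset ?_) (fun b' H hoff => ?_)
  · -- the member
    rw [Finset.mem_singleton] at hbS
    subst hbS
    dsimp only
    rw [← hs₀]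
    refine ⟨hS', fun q hq => ?_, hacc₀⟩
    rcases hreach q hq with rfl | ⟨e, he, rfl⟩ <;> dsimp only
    · -- over the member
      rw [hplan₀, hleaves₀]
      refine ⟨hP1, hP2, fun l hl _ => ⟨acc_edge_of_no_pairs _ (hdead_leaf l hl),
        fun s' hs' => finite_pairs_of_no_pairs _ (hdead_leaf l hl) s' hs'⟩, hcover⟩
    · -- over a child: dead
      rw [hplan₁ e he, hleaves₁ e he]
      exact ⟨fun e' he' => absurd he' (Finset.notMem_empty e'), fun e' he' => absurd he' (Finset.notMem_empty e'),
        fun l hl => absurd hl (Finset.notMem_empty l),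
        fun j'' b'' hj'' hb'' _ heq => absurd heq (hdead_child e he j'' b'' hj'' hb'')⟩
  · -- one member only
    rw [Finset.mem_singleton] at hbS hbS'
    exact absurd (hbS.trans hbS'.symm) hne'
  · -- no root parameter off the member
    rintro b' ⟨H, hoff'⟩
    exact hoff' (b₀, S) (Finset.mem_singleton_self _) (hroots b' H)
  · exfalso
    exact hoff (b₀, S) (Finset.mem_singleton_self _) (hroots b' H)

end Kit

end Equimultiple

end Summit.ResolutionOfSingularities.ResolutionOfSingularities.Theorems.PIDim4

end
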